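import Summits.PneNP.PneNP.Theses.BavardGap
import Literature.Computability.Complexity.KarpCliqueNP
import Literature.Computability.Complexity.CodeFPLists
import Literature.Computability.Complexity.CodeFPListKit
import Literature.Computability.Complexity.CodeFPStrings
import Literature.Computability.Complexity.CanonicalCodes
import Literature.Computability.Complexity.CodeFPClosure

/-!
# Route BavardGap — the typed verifier of the pairing-genus language (helper for `PgDecisionInNP`, stmt-PneNP-2498)

On `(x, p)` — the input `x = ⟨W, 1ᵗ⟩` (`W` = two bits per letter) and the certificate `p` (the pairing `π` as its list of
images) — ONE typed `CodeFP` program tests: `x` well paired with an even first and an all-ones second field; `p` a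
permutation of `[0, n)` (`n = |W|/2`: right length, entries `< n`, no duplicates) that is a fixed-point-free involution
matching each letter with an inverse letter; and the genus inequality `n/2 + 1 ≤ 2t + #cycles(σ)`, `σ = π ∘ rotate`, the
cycles (fixed points included) being counted as ORBIT MINIMA, each recognised by one fold over the first `n` iterates.
The program is packaged with its SPECIFICATION (`bavardGap_exists_pgTest`).
-/

set_option linter.dupNamespace false -- `Summit.PneNP.PneNP.…`: summit = sub-problem name (D-0017 single-conjunct layout)

namespace Summit.PneNP.PneNP.Theorems

open _root_.Computability Polynomial
open Literature.Computability.Complexity Literature.Computability.Complexity.CodeFP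
  Literature.Computability.Complexity.Brick

/-- **The orbit fold**: the state `(current iterate, [i ≤ every iterate so far])` after folding over a list of length `k`.
[folklore] -/
theorem bavardGap_fold_spec (p : List ℕ) (n i : ℕ) : ∀ (l : List ℕ) (b : ℕ × Bool),
    (l.foldl (fun b _ => (p.getD ((b.1 + 1) % n) 0, b.2 && decide (i ≤ p.getD ((b.1 + 1) % n) 0))) b).1 =
        (fun c => p.getD ((c + 1) % n) 0)^[l.length] b.1 ∧
      ((l.foldl (fun b _ => (p.getD ((b.1 + 1) % n) 0, b.2 && decide (i ≤ p.getD ((b.1 + 1) % n) 0))) b).2 = true ↔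
        (b.2 = true ∧ ∀ j, j < l.length → i ≤ (fun c => p.getD ((c + 1) % n) 0)^[j + 1] b.1))
  | [], b => by simp
  | a :: l, b => by
    obtain ⟨h1, h2⟩ := bavardGap_fold_spec p n i l (p.getD ((b.1 + 1) % n) 0, b.2 && decide (i ≤ p.getD ((b.1 + 1) % n) 0))
    rw [List.foldl_cons]
    refine ⟨?_, ?_⟩
    · rw [h1, List.length_cons, Function.iterate_succ_apply]
    · rw [h2, List.length_cons, Bool.and_eq_true, decide_eq_true_eq, and_assoc]
      refine and_congr_right fun _ => ⟨fun ⟨h0, h⟩ j hj => ?_, fun h => ⟨?_, fun j hj => ?_⟩⟩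
      · rcases j with _ | j
        · simpa using h0
        · have := h j (by omega)
          rwa [Function.iterate_succ_apply] at this
      · simpa using h 0 (by omega)
      · have := h (j + 1) (by omega)
        rwa [Function.iterate_succ_apply]

/-- Sums of indicators count. [folklore] -/
theorem bavardGap_sum_map_ite (l : List ℕ) (f : ℕ → Bool) : (l.map fun i => if f i then 1 else 0).sum = (l.filter f).length := by
  induction l with
  | nil => rfl
  | cons a l ih => cases h : f a <;> simp [h, ih, Nat.add_comm]

/-- **The typed verifier and its specification.** [cite: AroraBarakCC2009, §1.3] [folklore] -/
theorem bavardGap_exists_pgTest :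
    ∃ τ : List Bool × List ℕ → Bool, CodeFP (pairE strE (listE natE)) bitE τ ∧ ∀ (x : List Bool) (p : List ℕ), τ (x, p) = true ↔
      (boolPair (fstF x) (sndF x) = x ∧ (fstF x).length % 2 = 0 ∧ sndF x = List.replicate (sndF x).length true ∧
        p.length = (fstF x).length / 2 ∧ (∀ a ∈ p, a < (fstF x).length / 2) ∧ p.Nodup ∧
        (∀ i, i < (fstF x).length / 2 → p.getD (p.getD i 0) 0 = i ∧ p.getD i 0 ≠ i ∧
          (fstF x).getD (2 * p.getD i 0) false = (fstF x).getD (2 * i) false ∧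
          (fstF x).getD (2 * p.getD i 0 + 1) false = !(fstF x).getD (2 * i + 1) false) ∧
        (fstF x).length / 2 / 2 + 1 ≤ 2 * (sndF x).length +
          ((List.range ((fstF x).length / 2)).filter fun i => decide (∀ k, k < (fstF x).length / 2 + 1 →
            i ≤ (fun c => p.getD ((c + 1) % ((fstF x).length / 2)) 0)^[k] i)).length) := by
  -- string-level pieces
  have hfst : CodeFP strE strE fun w : List Bool => fstF w := CodeFP.of_fn fstF fstF_mem_FP fun _ => rfl
  have hsnd : CodeFP strE strE fun w : List Bool => sndF w := CodeFP.of_fn sndF sndF_mem_FP fun _ => rfl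
  have hwp0 : CodeFP strE bitE fun w : List Bool => decide (boolPair (fstF w) (sndF w) = w) :=
    CodeFP.of_fn CliqueNP.wpF CliqueNP.wpF_mem_FP fun w => by rw [CliqueNP.wpF_apply]; rfl
  have hones0 : CodeFP strE strE fun w : List Bool => List.replicate w.length true :=
    CodeFP.of_fn onesFn onesFn_mem_FP fun w => (unE_eq_ones w.length).trans rfl
  have hall1 : CodeFP strE bitE fun w : List Bool => decide (w = List.replicate w.length true) :=
    ((CodeFP.eq (α := List Bool) (eα := strE) Function.injective_id).comp ((CodeFP.id strE).pair hones0) :)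
  -- the data `W, U, n, t, p`
  have hx : CodeFP (pairE strE (listE natE)) strE fun t : List Bool × List ℕ => t.1 := CodeFP.fst _ _
  have hp : CodeFP (pairE strE (listE natE)) (rawE natE) fun t : List Bool × List ℕ => t.2 := ((rawOfList natE).comp (CodeFP.snd _ _) :)
  have hW : CodeFP (pairE strE (listE natE)) strE fun t : List Bool × List ℕ => fstF t.1 := (hfst.comp hx :)
  have hU : CodeFP (pairE strE (listE natE)) strE fun t : List Bool × List ℕ => sndF t.1 := (hsnd.comp hx :)
  have hn2 : CodeFP (pairE strE (listE natE)) natE fun t : List Bool × List ℕ => (fstF t.1).length := (natOfUn.comp (strLength.comp hW) :)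
  have hn : CodeFP (pairE strE (listE natE)) natE fun t : List Bool × List ℕ => (fstF t.1).length / 2 :=
    (natDiv.comp (hn2.pair (CodeFP.const _ 2)) :)
  have ht : CodeFP (pairE strE (listE natE)) natE fun t : List Bool × List ℕ => (sndF t.1).length := (natOfUn.comp (strLength.comp hU) :)
  have hR : CodeFP (pairE strE (listE natE)) (rawE natE) fun t : List Bool × List ℕ => List.range (min ((fstF t.1).length / 2) t.1.length) :=
    (rangeOf.comp ((strLength.comp hx).pair hn) :)
  -- simple tests
  have c1 : CodeFP (pairE strE (listE natE)) bitE fun t : List Bool × List ℕ => decide (boolPair (fstF t.1) (sndF t.1) = t.1) := (hwp0.comp hx :)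
  have c2 : CodeFP (pairE strE (listE natE)) bitE fun t : List Bool × List ℕ => decide ((fstF t.1).length % 2 = 0) :=
    (natEq.comp ((natMod.comp (hn2.pair (CodeFP.const _ 2))).pair (CodeFP.const _ 0)) :)
  have c3 : CodeFP (pairE strE (listE natE)) bitE fun t : List Bool × List ℕ => decide (sndF t.1 = List.replicate (sndF t.1).length true) :=
    (hall1.comp hU :)
  have c4 : CodeFP (pairE strE (listE natE)) bitE fun t : List Bool × List ℕ => decide (t.2.length = (fstF t.1).length / 2) :=
    (natEq.comp (((natLength natE).comp hp).pair hn) :)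
  have c5 : CodeFP (pairE strE (listE natE)) bitE fun t : List Bool × List ℕ => t.2.all fun a => decide (a < (fstF t.1).length / 2) :=
    ((CodeFP.all (σ := ℕ) (eσ := natE) (natLt.comp ((CodeFP.snd natE natE).pair (CodeFP.fst natE natE)) :)).comp (hn.pair hp) :)
  have c6 : CodeFP (pairE strE (listE natE)) bitE fun t : List Bool × List ℕ => decide t.2.Nodup := ((CodeFP.nodup natE_injective).comp hp :)
  -- the per-index pairing conditions, on `e = ((((W, p), n), R), i)`
  have eW : CodeFP (pairE (pairE (pairE (pairE strE (rawE natE)) natE) (rawE natE)) natE) strE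
      fun e : (((List Bool × List ℕ) × ℕ) × List ℕ) × ℕ => e.1.1.1.1 := (CodeFP.fst _ _).fst'.fst'.fst'
  have ep : CodeFP (pairE (pairE (pairE (pairE strE (rawE natE)) natE) (rawE natE)) natE) (rawE natE)
      fun e : (((List Bool × List ℕ) × ℕ) × List ℕ) × ℕ => e.1.1.1.2 := (CodeFP.fst _ _).fst'.fst'.snd'
  have en : CodeFP (pairE (pairE (pairE (pairE strE (rawE natE)) natE) (rawE natE)) natE) natE
      fun e : (((List Bool × List ℕ) × ℕ) × List ℕ) × ℕ => e.1.1.2 := (CodeFP.fst _ _).fst'.snd'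
  have eR : CodeFP (pairE (pairE (pairE (pairE strE (rawE natE)) natE) (rawE natE)) natE) (rawE natE)
      fun e : (((List Bool × List ℕ) × ℕ) × List ℕ) × ℕ => e.1.2 := (CodeFP.fst _ _).snd'
  have ei : CodeFP (pairE (pairE (pairE (pairE strE (rawE natE)) natE) (rawE natE)) natE) natE
      fun e : (((List Bool × List ℕ) × ℕ) × List ℕ) × ℕ => e.2 := CodeFP.snd _ _
  have hget : CodeFP (pairE (rawE natE) natE) natE fun q : List ℕ × ℕ => q.1.getD q.2 0 := rawGetD natE rfl
  have epi : CodeFP (pairE (pairE (pairE (pairE strE (rawE natE)) natE) (rawE natE)) natE) natE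
      fun e : (((List Bool × List ℕ) × ℕ) × List ℕ) × ℕ => e.1.1.1.2.getD e.2 0 := (hget.comp (ep.pair ei) :)
  have eppi : CodeFP (pairE (pairE (pairE (pairE strE (rawE natE)) natE) (rawE natE)) natE) natE
      fun e : (((List Bool × List ℕ) × ℕ) × List ℕ) × ℕ => e.1.1.1.2.getD (e.1.1.1.2.getD e.2 0) 0 := (hget.comp (ep.pair epi) :)
  have ebit : ∀ {U : ((((List Bool × List ℕ) × ℕ) × List ℕ) × ℕ) → ℕ},
      CodeFP (pairE (pairE (pairE (pairE strE (rawE natE)) natE) (rawE natE)) natE) natE U →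
      CodeFP (pairE (pairE (pairE (pairE strE (rawE natE)) natE) (rawE natE)) natE) bitE fun e => e.1.1.1.1.getD (U e) false :=
    fun hU => (strGetDNat.comp (eW.pair hU) :)
  have e2pi : CodeFP (pairE (pairE (pairE (pairE strE (rawE natE)) natE) (rawE natE)) natE) natE
      fun e : (((List Bool × List ℕ) × ℕ) × List ℕ) × ℕ => 2 * e.1.1.1.2.getD e.2 0 := (natMul.comp ((CodeFP.const _ 2).pair epi) :)
  have e2i : CodeFP (pairE (pairE (pairE (pairE strE (rawE natE)) natE) (rawE natE)) natE) natE
      fun e : (((List Bool × List ℕ) × ℕ) × List ℕ) × ℕ => 2 * e.2 := (natMul.comp ((CodeFP.const _ 2).pair ei) :)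
  have e2pi1 : CodeFP (pairE (pairE (pairE (pairE strE (rawE natE)) natE) (rawE natE)) natE) natE
      fun e : (((List Bool × List ℕ) × ℕ) × List ℕ) × ℕ => 2 * e.1.1.1.2.getD e.2 0 + 1 := (natAdd.comp (e2pi.pair (CodeFP.const _ 1)) :)
  have e2i1 : CodeFP (pairE (pairE (pairE (pairE strE (rawE natE)) natE) (rawE natE)) natE) natE
      fun e : (((List Bool × List ℕ) × ℕ) × List ℕ) × ℕ => 2 * e.2 + 1 := (natAdd.comp (e2i.pair (CodeFP.const _ 1)) :)
  have hcond : CodeFP (pairE (pairE (pairE (pairE strE (rawE natE)) natE) (rawE natE)) natE) bitE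
      fun e : (((List Bool × List ℕ) × ℕ) × List ℕ) × ℕ =>
        decide (e.1.1.1.2.getD (e.1.1.1.2.getD e.2 0) 0 = e.2) && (!decide (e.1.1.1.2.getD e.2 0 = e.2) &&
          ((e.1.1.1.1.getD (2 * e.1.1.1.2.getD e.2 0) false == e.1.1.1.1.getD (2 * e.2) false) &&
            (e.1.1.1.1.getD (2 * e.1.1.1.2.getD e.2 0 + 1) false == !e.1.1.1.1.getD (2 * e.2 + 1) false))) :=
    (natEq.comp (eppi.pair ei) :).and ((natEq.comp (epi.pair ei) :).not.and
      (((CodeFP.beq bitE_injective).comp ((ebit e2pi).pair (ebit e2i)) :).and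
        ((CodeFP.beq bitE_injective).comp ((ebit e2pi1).pair (ebit e2i1).not) :)))
  -- the orbit-minimum fold, context `s = ((p, n), i)`, state `(cur, ok)`
  have hsig : ∀ {P : (((List ℕ × ℕ) × ℕ) × (ℕ × (ℕ × Bool))) → List ℕ} {N C : (((List ℕ × ℕ) × ℕ) × (ℕ × (ℕ × Bool))) → ℕ},
      CodeFP (pairE (pairE (pairE (rawE natE) natE) natE) (pairE natE (pairE natE bitE))) (rawE natE) P →
      CodeFP (pairE (pairE (pairE (rawE natE) natE) natE) (pairE natE (pairE natE bitE))) natE N →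
      CodeFP (pairE (pairE (pairE (rawE natE) natE) natE) (pairE natE (pairE natE bitE))) natE C →
      CodeFP (pairE (pairE (pairE (rawE natE) natE) natE) (pairE natE (pairE natE bitE))) natE fun q => (P q).getD ((C q + 1) % N q) 0 :=
    fun hP hN hC => (hget.comp (hP.pair (natMod.comp ((natAdd.comp (hC.pair (CodeFP.const _ 1))).pair hN))) :)
  have sP : CodeFP (pairE (pairE (pairE (rawE natE) natE) natE) (pairE natE (pairE natE bitE))) (rawE natE)
      fun q : ((List ℕ × ℕ) × ℕ) × (ℕ × (ℕ × Bool)) => q.1.1.1 := (CodeFP.fst _ _).fst'.fst'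
  have sN : CodeFP (pairE (pairE (pairE (rawE natE) natE) natE) (pairE natE (pairE natE bitE))) natE
      fun q : ((List ℕ × ℕ) × ℕ) × (ℕ × (ℕ × Bool)) => q.1.1.2 := (CodeFP.fst _ _).fst'.snd'
  have sI : CodeFP (pairE (pairE (pairE (rawE natE) natE) natE) (pairE natE (pairE natE bitE))) natE
      fun q : ((List ℕ × ℕ) × ℕ) × (ℕ × (ℕ × Bool)) => q.1.2 := (CodeFP.fst _ _).snd'
  have sC : CodeFP (pairE (pairE (pairE (rawE natE) natE) natE) (pairE natE (pairE natE bitE))) natE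
      fun q : ((List ℕ × ℕ) × ℕ) × (ℕ × (ℕ × Bool)) => q.2.2.1 := (CodeFP.snd _ _).snd'.fst'
  have sO : CodeFP (pairE (pairE (pairE (rawE natE) natE) natE) (pairE natE (pairE natE bitE))) bitE
      fun q : ((List ℕ × ℕ) × ℕ) × (ℕ × (ℕ × Bool)) => q.2.2.2 := (CodeFP.snd _ _).snd'.snd'
  have snext := hsig sP sN sC
  have hstep : CodeFP (pairE (pairE (pairE (rawE natE) natE) natE) (pairE natE (pairE natE bitE))) (pairE natE bitE)
      fun q : ((List ℕ × ℕ) × ℕ) × (ℕ × (ℕ × Bool)) =>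
        (q.1.1.1.getD ((q.2.2.1 + 1) % q.1.1.2) 0, q.2.2.2 && decide (q.1.2 ≤ q.1.1.1.getD ((q.2.2.1 + 1) % q.1.1.2) 0)) :=
    snext.pair (sO.and (natLe.comp (sI.pair snext) :))
  have hinit : CodeFP (pairE (pairE (rawE natE) natE) natE) (pairE natE bitE) fun s : (List ℕ × ℕ) × ℕ => (s.2, true) :=
    (CodeFP.snd _ _).pair (CodeFP.const _ true)
  have hfold : CodeFP (pairE (pairE (pairE (rawE natE) natE) natE) (rawE natE)) (pairE natE bitE)
      fun q : ((List ℕ × ℕ) × ℕ) × List ℕ => q.2.foldl (fun b _ => (q.1.1.1.getD ((b.1 + 1) % q.1.1.2) 0,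
        b.2 && decide (q.1.2 ≤ q.1.1.1.getD ((b.1 + 1) % q.1.1.2) 0))) (q.1.2, true) := by
    refine CodeFP.foldl (step := fun (s : (List ℕ × ℕ) × ℕ) (_ : ℕ) (b : ℕ × Bool) =>
      (s.1.1.getD ((b.1 + 1) % s.1.2) 0, b.2 && decide (s.2 ≤ s.1.1.getD ((b.1 + 1) % s.1.2) 0)))
      (init := fun s => (s.2, true)) hstep hinit (2 * X + 3) fun s l₁ l₂ => ?_
    have h1 := (bavardGap_fold_spec s.1.1 s.1.2 s.2 l₁ (s.2, true)).1
    set r := l₁.foldl (fun b _ => (s.1.1.getD ((b.1 + 1) % s.1.2) 0, b.2 && decide (s.2 ≤ s.1.1.getD ((b.1 + 1) % s.1.2) 0))) (s.2, true)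
      with hr
    have hcur : (natE r.1).length ≤ (natE s.2).length + (rawE natE s.1.1).length := by
      rw [h1]
      rcases l₁.length with _ | k
      · simp
      · rw [Function.iterate_succ_apply']
        exact (MinLabel.length_natE_getD_le _ _).trans (Nat.le_add_left _ _)
    simp only [pairE_apply, length_boolPair, eval_add, eval_mul, eval_X, eval_ofNat, bitE]
    simp only [List.length_singleton]
    omega
  -- `isMin` on `e = ((((W, p), n), R), i)` and the count `Q` on `c = (((W, p), n), R)`
  have hisMin := ((CodeFP.snd _ _).comp (hfold.comp (((ep.pair en).pair ei).pair eR)) :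
    CodeFP (pairE (pairE (pairE (pairE strE (rawE natE)) natE) (rawE natE)) natE) bitE fun e => _)
  have hind : CodeFP (pairE (pairE (pairE (pairE strE (rawE natE)) natE) (rawE natE)) natE) natE
      fun e : (((List Bool × List ℕ) × ℕ) × List ℕ) × ℕ => if (e.1.2.foldl (fun b _ => (e.1.1.1.2.getD ((b.1 + 1) % e.1.1.2) 0,
        b.2 && decide (e.2 ≤ e.1.1.1.2.getD ((b.1 + 1) % e.1.1.2) 0))) (e.2, true)).2 then 1 else 0 :=
    hisMin.ite (CodeFP.const _ 1) (CodeFP.const _ 0)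
  have hQ := (natSum.comp ((CodeFP.map hind).comp ((CodeFP.id _).pair (CodeFP.snd _ _))) :
    CodeFP (pairE (pairE (pairE strE (rawE natE)) natE) (rawE natE)) natE fun c => _)
  have hconds := ((CodeFP.all hcond).comp ((CodeFP.id _).pair (CodeFP.snd _ _)) :
    CodeFP (pairE (pairE (pairE strE (rawE natE)) natE) (rawE natE)) bitE fun c => _)
  have hctx : CodeFP (pairE strE (listE natE)) (pairE (pairE (pairE strE (rawE natE)) natE) (rawE natE))
      fun t : List Bool × List ℕ => (((fstF t.1, t.2), (fstF t.1).length / 2), List.range (min ((fstF t.1).length / 2) t.1.length)) :=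
    ((hW.pair hp).pair hn).pair hR
  have c7 := (hconds.comp hctx :)
  have c8 := (natLe.comp ((natAdd.comp ((natDiv.comp (hn.pair (CodeFP.const _ 2))).pair (CodeFP.const _ 1))).pair
    (natAdd.comp ((natMul.comp ((CodeFP.const _ 2).pair ht)).pair (hQ.comp hctx)))) :)
  refine ⟨_, c1.and (c2.and (c3.and (c4.and (c5.and (c6.and (c7.and c8)))))), fun x p => ?_⟩
  -- the specification
  have hle : (fstF x).length / 2 ≤ x.length := by
    have h := length_boolUnpair_parts_le x
    change 2 * (fstF x).length + (sndF x).length ≤ x.length at h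
    omega
  simp only [id, Bool.and_eq_true, decide_eq_true_eq, List.all_eq_true, List.mem_range, min_eq_left hle,
    Bool.not_eq_true', decide_eq_false_iff_not, beq_iff_eq]
  refine and_congr_right fun _ => and_congr_right fun _ => and_congr_right fun _ => and_congr_right fun _ =>
    and_congr_right fun _ => and_congr_right fun _ => and_congr (forall₂_congr fun i _ => ?_) ?_
  · exact Iff.rfl
  · rw [bavardGap_sum_map_ite]
    refine Iff.of_eq (congrArg _ (congrArg _ (congrArg _ ?_)))
    refine List.filter_congr fun i hi => ?_
    rw [List.mem_range] at hi
    rw [Bool.eq_iff_iff, (bavardGap_fold_spec p _ i (List.range _) (i, true)).2, decide_eq_true_iff]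
    simp only [true_and, List.length_range]
    constructor
    · intro h k hk
      rcases k with _ | k
      · exact le_rfl
      · exact h k (by omega)
    · intro h j hj
      exact h (j + 1) (by omega)

end Summit.PneNP.PneNP.Theorems
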